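import Mathlib
import HarnessLib
import Literature.Probability.LatticeModels.TorusFourierFirstMoment
import Literature.Probability.LatticeModels.TorusFourierWeightedL1ProdMoment
import Literature.MathematicalPhysics.QuantumLattice.HubbardUVGridSymbolBand

/-!
# The first SPACE moment of the character sum of one telescoping PIECE of the scale-`0` covariance symbol, uniform in `M`, `β`, `L`

Topic `MathematicalPhysics/QuantumLattice`; continues `HubbardUVGridSymbolBand` (the two `ℓ²` grid sums) — the space-moment twin of
k3c4-p2's `HubbardUVCovarianceCTTimeMoment`.  A PIECE is a padded grid function `P(q₀,q⃗) = [val q₀ < 2M]·(βL²)⁻²·Φ(ω̃_{q₀})(q⃗)` on the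
dual torus `(ℤ/N) × (ℤ/L)²` built from a frequency-indexed lattice family `Φ(ω) : (ℤ/L)² → ℂ` (for the scale-`0` covariance of a framed
band: `Φ(ω)(q⃗) = Ψ(ω, b_{-1}(q⃗))` for the bare piece and `Ψ(ω, bₘ(q⃗)) − Ψ(ω, b_{m-1}(q⃗))` for the increment of the `m`-th frame piece,
Benfatto–Giuliani–Mastropietro 2006, §3 (3.2)–(3.8)).  From FIBREWISE bounds on the mixed space differences of `Φ(ω)` — the value bound
`(2π/L)ᵏ·βL²·Q_k·2/max(|ω|,Λ/2)` and the one-Matsubara-step increment bound `(2π/L)ᵏ·(2π/β)·βL²·Q′_k·2/max(|ω| − 2π/β, Λ/2)`,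
`k = a + b ≤ 3` — this file derives

* `spaceDiff_window` — space differences act inside the window of an abstract piece;
* `uvPieceSq Λ Q Q′ t k`, **`sum_norm_sq_spaceDiff_piece_le`**, **`sum_norm_sq_timeDiff_spaceDiff_piece_le`** — the compact majorants
  `Σ_{q₀,q⃗}‖Δ_u^t Δ_{e_l}^aΔ_{e_{l'}}^b P‖² ≤ uvPieceSq(t, a+b)/(L^{2(a+b)+2}·β^{2t+1})` (`t ∈ {0,1}`, `2 ≤ β`, `β³ ≤ M`, `2M ≤ N`; the two
  edge rows absorbed by `β³ ≤ M`);
* **`sum_sum_spaceWeight_mul_norm_charSum_le`** — the weighted Plancherel inequality with the monomial `4|b̃_l|/L`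
  (`TorusFourierWeightedL1ProdMoment.sum_sum_monomial_mul_norm_prodChar_le_prodWeight`, `n = (0,1,0)`, `N = (1,1,1)`, product weight
  `(1+(ã/R₀)²)(1+(b̃₀/R)²)(1+(b̃₁/R)²)`) against an abstract table `Kq t k` of compact `ℓ²` majorants;
* `uvSpaceMomentConst Λ R Kq`, **`spaceMoment_charSum_piece_le`** — the normalised, `M`-, `β`-, `L`-uniform form
  `(β/N)·Σ_{a,b⃗} |b̃_l|·‖S[P](a,b⃗)‖ ≤ uvSpaceMomentConst Λ R Kq` (`R₀ = ⌈N/(βΛ)⌉`).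

Everything is proved; `uvPieceSq` and `uvSpaceMomentConst` are the only definitions; no named facts.

## Sources

G. Benfatto, A. Giuliani, V. Mastropietro, Ann. Henri Poincaré 7 (2006) 809–898, §2.1 Lemma 2.2, (2.36aa), §2.8 (2.80)–(2.81),
§3 (3.2)–(3.8) (`BenfattoGiulianiMastropietro2006`); W. de Siqueira Pedra, M. Salmhofer, Comm. Math. Phys. 282 (2008) 797–818, §4
Cor. 4.4 (`PedraSalmhofer2008`).
-/

noncomputable section

namespace Literature.MathematicalPhysics.QuantumLattice

open Literature.Probability.LatticeModels Finset Complex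

variable {L M N : ℕ}

/-! ### §1 Space differences of an abstract piece -/

section Window

variable {β : ℝ}

/-- **Space differences act inside the window** of a piece `P(q₀) = [val q₀ < 2M]·c²·Φ(ω̃_{q₀})`. [cite: BenfattoGiulianiMastropietro2006, (2.36aa)] -/
theorem spaceDiff_window (c : ℝ) (Φ : ℝ → TorusSite 2 L → ℂ) (P : TorusSite 1 N → TorusSite 2 L → ℂ)
    (hP : ∀ q₀ qv, P q₀ qv = if (q₀ 0).val < 2 * M then ((c : ℝ) : ℂ) ^ 2 * Φ (gridFreq M N β q₀) qv else 0)
    (v₁ v₂ : TorusSite 2 L) (a b : ℕ) (q₀ : TorusSite 1 N) (qv : TorusSite 2 L) :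
    (fwdDiff v₁)^[a] ((fwdDiff v₂)^[b] (P q₀)) qv =
      if (q₀ 0).val < 2 * M then ((c : ℝ) : ℂ) ^ 2 * (fwdDiff v₁)^[a] ((fwdDiff v₂)^[b] (Φ (gridFreq M N β q₀))) qv else 0 := by
  by_cases h : (q₀ 0).val < 2 * M
  · have hG : P q₀ = fun qv => ((c : ℝ) : ℂ) ^ 2 * Φ (gridFreq M N β q₀) qv := by funext qv'; rw [hP, if_pos h]
    rw [hG, if_pos h, fwdDiff_iter₂_const_mul]
  · have hG : P q₀ = fun _ => (0 : ℂ) := by funext qv'; rw [hP, if_neg h]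
    rw [hG, if_neg h, fwdDiff_iter_zero_fun, fwdDiff_iter_zero_fun]

end Window

/-! ### §2 The compact `ℓ²` majorants of a piece -/

/-- **The compact majorant of a piece** with value amplitudes `Q_k` and increment amplitudes `Q′_k`:
`t = 0`: `(2π)^{2k}(8/Λ)Q_k²`; `t = 1`: `(2π)^{2k+2}·16·Q′_k²·(2/Λ + 2/Λ²) + 2(2π)^{2k}Q_k²/π²`. [cite: BenfattoGiulianiMastropietro2006, (2.36aa)] -/
def uvPieceSq (Λ : ℝ) (Q Q' : ℕ → ℝ) (t k : ℕ) : ℝ :=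
  if t = 0 then (2 * Real.pi) ^ (2 * k) * (8 / Λ) * Q k ^ 2
  else (2 * Real.pi) ^ (2 * k + 2) * 16 * Q' k ^ 2 * (2 / Λ + 2 / Λ ^ 2) + 2 * (2 * Real.pi) ^ (2 * k) * Q k ^ 2 / Real.pi ^ 2

/-- `uvPieceSq ≥ 0` (`0 < Λ`). [cite: BenfattoGiulianiMastropietro2006, (2.36aa)] -/
theorem uvPieceSq_nonneg {Λ : ℝ} (hΛ : 0 < Λ) (Q Q' : ℕ → ℝ) (t k : ℕ) : 0 ≤ uvPieceSq Λ Q Q' t k := by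
  unfold uvPieceSq; split_ifs <;> positivity

/-- The `L`, `β` bookkeeping of the no-time-difference majorant (pure algebra). [cite: BenfattoGiulianiMastropietro2006, §2.8 (2.80)] -/
theorem piece_algebra_t0 {β Λ L X Y Qk : ℝ} (hβ : 0 < β) (hΛ : 0 < Λ) (hL : 0 < L) (hY : 0 < Y) :
    L ^ 2 * ((1 / (β * L ^ 2)) ^ 4 * (X / Y * (β * L ^ 2 * Qk)) ^ 2 * (4 * (2 * β / Λ))) =
      X ^ 2 * (8 / Λ) * Qk ^ 2 / (Y ^ 2 * L ^ 2 * β ^ (2 * 0 + 1)) := by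
  field_simp
  ring

/-- The `L`, `β` bookkeeping of the one-time-difference majorant (pure algebra; `2 ≤ β`, `8 ≤ β³`, edge envelope `E ≤ 2/(πβ²)`).
[cite: BenfattoGiulianiMastropietro2006, §2.8 (2.80)] -/
theorem piece_algebra_t1 {β Λ L X Y Qk Q'k E : ℝ} (hβ2 : 2 ≤ β) (h8 : 8 ≤ β ^ 3) (hΛ : 0 < Λ) (hL : 0 < L) (hY : 0 < Y)
    (hE0 : 0 ≤ E) (hE : E ≤ 2 / (Real.pi * β ^ 2)) :
    L ^ 2 * ((1 / (β * L ^ 2)) ^ 4 *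
        ((X / Y * (2 * Real.pi / β * (β * L ^ 2 * Q'k))) ^ 2 * (4 * (4 * (2 * β / Λ) + 4 * (2 / Λ) ^ 2)) +
          4 * (X / Y * (β * L ^ 2 * Qk)) ^ 2 * E ^ 2)) ≤
      (X ^ 2 * (2 * Real.pi) ^ 2 * 16 * Q'k ^ 2 * (2 / Λ + 2 / Λ ^ 2) + 2 * X ^ 2 * Qk ^ 2 / Real.pi ^ 2) /
        (Y ^ 2 * L ^ 2 * β ^ (2 * 1 + 1)) := by
  have hβ : 0 < β := by linarith
  have hext2 : E ^ 2 ≤ (2 / (Real.pi * β ^ 2)) ^ 2 := pow_le_pow_left₀ hE0 hE 2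
  -- `4(2β/Λ) + 4(2/Λ)² ≤ β·4(2/Λ + 2/Λ²)` (uses `β ≥ 2`)
  have hb1 : 4 * (2 * β / Λ) + 4 * (2 / Λ) ^ 2 ≤ β * (4 * (2 / Λ + 2 / Λ ^ 2)) := by
    have h16 : (16 : ℝ) / Λ ^ 2 ≤ 8 * β / Λ ^ 2 := div_le_div_of_nonneg_right (by linarith) (by positivity)
    have e1 : 4 * (2 / Λ) ^ 2 = (16 : ℝ) / Λ ^ 2 := by rw [div_pow]; ring
    have e2 : β * (4 * (2 / Λ + 2 / Λ ^ 2)) = 4 * (2 * β / Λ) + 8 * β / Λ ^ 2 := by ring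
    rw [e1, e2]; linarith
  set D : ℝ := Y ^ 2 * L ^ 2 with hDdef
  have hD0 : 0 < D := by positivity
  have hT1 : L ^ 2 * ((1 / (β * L ^ 2)) ^ 4 *
      ((X / Y * (2 * Real.pi / β * (β * L ^ 2 * Q'k))) ^ 2 * (4 * (4 * (2 * β / Λ) + 4 * (2 / Λ) ^ 2)))) =
      4 * (4 * (2 * β / Λ) + 4 * (2 / Λ) ^ 2) * (X ^ 2 * (2 * Real.pi) ^ 2 * Q'k ^ 2) / (β ^ 4 * D) := by
    rw [hDdef]; field_simp
  have hT2 : L ^ 2 * ((1 / (β * L ^ 2)) ^ 4 * (4 * (X / Y * (β * L ^ 2 * Qk)) ^ 2 * E ^ 2)) =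
      4 * E ^ 2 * (X ^ 2 * Qk ^ 2) / (β ^ 2 * D) := by
    rw [hDdef]; field_simp
  have hsplit : L ^ 2 * ((1 / (β * L ^ 2)) ^ 4 *
      ((X / Y * (2 * Real.pi / β * (β * L ^ 2 * Q'k))) ^ 2 * (4 * (4 * (2 * β / Λ) + 4 * (2 / Λ) ^ 2)) +
        4 * (X / Y * (β * L ^ 2 * Qk)) ^ 2 * E ^ 2)) =
      4 * (4 * (2 * β / Λ) + 4 * (2 / Λ) ^ 2) * (X ^ 2 * (2 * Real.pi) ^ 2 * Q'k ^ 2) / (β ^ 4 * D) +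
        4 * E ^ 2 * (X ^ 2 * Qk ^ 2) / (β ^ 2 * D) := by
    rw [← hT1, ← hT2]; ring
  rw [hsplit]
  have key1 : 4 * (4 * (2 * β / Λ) + 4 * (2 / Λ) ^ 2) * (X ^ 2 * (2 * Real.pi) ^ 2 * Q'k ^ 2) / (β ^ 4 * D) ≤
      16 * (2 / Λ + 2 / Λ ^ 2) * (X ^ 2 * (2 * Real.pi) ^ 2 * Q'k ^ 2) / (β ^ (2 * 1 + 1) * D) := by
    have hnum : 4 * (4 * (2 * β / Λ) + 4 * (2 / Λ) ^ 2) * (X ^ 2 * (2 * Real.pi) ^ 2 * Q'k ^ 2) ≤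
        4 * (β * (4 * (2 / Λ + 2 / Λ ^ 2))) * (X ^ 2 * (2 * Real.pi) ^ 2 * Q'k ^ 2) :=
      mul_le_mul_of_nonneg_right (mul_le_mul_of_nonneg_left hb1 (by norm_num)) (by positivity)
    calc _ ≤ 4 * (β * (4 * (2 / Λ + 2 / Λ ^ 2))) * (X ^ 2 * (2 * Real.pi) ^ 2 * Q'k ^ 2) / (β ^ 4 * D) :=
          div_le_div_of_nonneg_right hnum (by positivity)
      _ = 16 * (2 / Λ + 2 / Λ ^ 2) * (X ^ 2 * (2 * Real.pi) ^ 2 * Q'k ^ 2) / (β ^ (2 * 1 + 1) * D) := by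
          field_simp; ring
  have key2 : 4 * E ^ 2 * (X ^ 2 * Qk ^ 2) / (β ^ 2 * D) ≤ 2 * (X ^ 2 * Qk ^ 2) / Real.pi ^ 2 / (β ^ (2 * 1 + 1) * D) := by
    have h1 : 4 * E ^ 2 * (X ^ 2 * Qk ^ 2) / (β ^ 2 * D) ≤ 4 * (2 / (Real.pi * β ^ 2)) ^ 2 * (X ^ 2 * Qk ^ 2) / (β ^ 2 * D) :=
      div_le_div_of_nonneg_right (mul_le_mul_of_nonneg_right (mul_le_mul_of_nonneg_left hext2 (by norm_num)) (by positivity))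
        (by positivity)
    refine h1.trans ?_
    rw [div_le_div_iff₀ (by positivity) (by positivity)]
    have hcore : 4 * (2 / (Real.pi * β ^ 2)) ^ 2 * (β ^ (2 * 1 + 1) * D) ≤ 2 / Real.pi ^ 2 * (β ^ 2 * D) := by
      rw [show 4 * (2 / (Real.pi * β ^ 2)) ^ 2 * (β ^ (2 * 1 + 1) * D) = 2 / Real.pi ^ 2 * (β ^ 2 * D) * (8 / β ^ 3) by
        field_simp; ring]
      have h83 : 8 / β ^ 3 ≤ 1 := by rw [div_le_one (by positivity)]; exact h8
      have hpos : 0 ≤ 2 / Real.pi ^ 2 * (β ^ 2 * D) := by positivity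
      nlinarith
    calc 4 * (2 / (Real.pi * β ^ 2)) ^ 2 * (X ^ 2 * Qk ^ 2) * (β ^ (2 * 1 + 1) * D)
        = (X ^ 2 * Qk ^ 2) * (4 * (2 / (Real.pi * β ^ 2)) ^ 2 * (β ^ (2 * 1 + 1) * D)) := by ring
      _ ≤ (X ^ 2 * Qk ^ 2) * (2 / Real.pi ^ 2 * (β ^ 2 * D)) := mul_le_mul_of_nonneg_left hcore (by positivity)
      _ = 2 * (X ^ 2 * Qk ^ 2) / Real.pi ^ 2 * (β ^ 2 * D) := by field_simp
  refine (add_le_add key1 key2).trans (le_of_eq ?_)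
  rw [hDdef]
  field_simp

section Compact

variable [NeZero L] [NeZero N] {β Λ : ℝ}

omit [NeZero L] [NeZero N] in
/-- `0 < β`, `1 ≤ M`, `8 ≤ β³`, `2M ≤ N` (as reals) from the thresholds `2 ≤ β`, `β³ ≤ M`, `2M ≤ N`.
[cite: BenfattoGiulianiMastropietro2006, §2.8 (2.81)] -/
theorem thresholds_aux (hβ2 : 2 ≤ β) (hβM : β ^ 3 ≤ (M : ℝ)) (hMN : 2 * M ≤ N) :
    0 < β ∧ 1 ≤ M ∧ (8 : ℝ) ≤ β ^ 3 ∧ 2 * (M : ℝ) ≤ N := by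
  have hβ0 : 0 < β := by linarith
  have h8 : (8 : ℝ) ≤ β ^ 3 := by nlinarith [sq_nonneg β, mul_pos hβ0 hβ0]
  have hM1 : 1 ≤ M := by
    have : (1 : ℝ) ≤ M := by linarith
    exact_mod_cast this
  have hMN' : 2 * (M : ℝ) ≤ N := by
    have : ((2 * M : ℕ) : ℝ) ≤ N := by exact_mod_cast hMN
    push_cast at this; linarith
  exact ⟨hβ0, hM1, h8, hMN'⟩

/-- **Compact majorant, no time difference**: `Σ_{q₀,q⃗}‖Δ_{v₁}^aΔ_{v₂}^b P(q₀)(q⃗)‖² ≤ uvPieceSq(0, a+b)/(L^{2(a+b)+2}·β)` from the value bound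
`‖Δ_{v₁}^aΔ_{v₂}^b Φ(ω)(q⃗)‖ ≤ (2π/L)^{a+b}·βL²·Q_{a+b}·2/max(|ω|,Λ/2)`. [cite: BenfattoGiulianiMastropietro2006, §2.8 (2.80)] -/
theorem sum_norm_sq_spaceDiff_piece_le (hβ : 0 < β) (hΛ : 0 < Λ) (hMN : 2 * M ≤ N) (Φ : ℝ → TorusSite 2 L → ℂ)
    (P : TorusSite 1 N → TorusSite 2 L → ℂ)
    (hP : ∀ q₀ qv, P q₀ qv = if (q₀ 0).val < 2 * M then ((1 / (β * (L : ℝ) ^ 2) : ℝ) : ℂ) ^ 2 * Φ (gridFreq M N β q₀) qv else 0)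
    (Q Q' : ℕ → ℝ) (v₁ v₂ : TorusSite 2 L) {a b : ℕ}
    (hV : ∀ ω qv, ‖(fwdDiff v₁)^[a] ((fwdDiff v₂)^[b] (Φ ω)) qv‖ ≤
      (2 * Real.pi / L) ^ (a + b) * (β * (L : ℝ) ^ 2 * Q (a + b)) * (2 / max |ω| (Λ / 2))) :
    ∑ q₀ : TorusSite 1 N, ∑ qv : TorusSite 2 L, ‖(fwdDiff v₁)^[a] ((fwdDiff v₂)^[b] (P q₀)) qv‖ ^ 2 ≤
      uvPieceSq Λ Q Q' 0 (a + b) / ((L : ℝ) ^ (2 * (a + b) + 2) * β ^ (2 * 0 + 1)) := by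
  have hL : (0 : ℝ) < L := by exact_mod_cast Nat.pos_of_ne_zero (NeZero.ne L)
  have h := sum_sum_norm_sq_window_le (L := L) (M := M) (N := N) hβ hΛ hMN (1 / (β * (L : ℝ) ^ 2))
    (fun ω => (fwdDiff v₁)^[a] ((fwdDiff v₂)^[b] (Φ ω))) hV
  have heq : ∀ q₀ qv, ‖(fwdDiff v₁)^[a] ((fwdDiff v₂)^[b] (P q₀)) qv‖ ^ 2 =
      ‖(if (q₀ 0).val < 2 * M then ((1 / (β * (L : ℝ) ^ 2) : ℝ) : ℂ) ^ 2 *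
        (fun ω => (fwdDiff v₁)^[a] ((fwdDiff v₂)^[b] (Φ ω))) (gridFreq M N β q₀) qv else 0)‖ ^ 2 := by
    intro q₀ qv; rw [spaceDiff_window _ Φ P hP]
  simp_rw [heq]
  rw [div_pow (2 * Real.pi) (L : ℝ) (a + b)] at h
  rw [uvPieceSq, if_pos rfl, show (2 * Real.pi) ^ (2 * (a + b)) = ((2 * Real.pi) ^ (a + b)) ^ 2 by ring,
    show (L : ℝ) ^ (2 * (a + b) + 2) = ((L : ℝ) ^ (a + b)) ^ 2 * (L : ℝ) ^ 2 by ring,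
    ← piece_algebra_t0 (X := (2 * Real.pi) ^ (a + b)) (Qk := Q (a + b)) hβ hΛ hL (by positivity)]
  exact h

/-- **Compact majorant, one time difference**: `Σ_{q₀,q⃗}‖Δ_u(Δ_{v₁}^aΔ_{v₂}^b P(·)(q⃗))(q₀)‖² ≤ uvPieceSq(1, a+b)/(L^{2(a+b)+2}·β³)` from the value
bound and the one-step increment bound `‖Δ^aΔ^b Φ(ω + 2π/β)(q⃗) − Δ^aΔ^b Φ(ω)(q⃗)‖ ≤ (2π/L)^{a+b}·(2π/β)·βL²·Q′_{a+b}·2/max(|ω| − 2π/β, Λ/2)`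
(`2 ≤ β`, `β³ ≤ M`, `2M ≤ N`). [cite: BenfattoGiulianiMastropietro2006, Lemma 2.2 and §2.8 (2.80)] -/
theorem sum_norm_sq_timeDiff_spaceDiff_piece_le (hβ2 : 2 ≤ β) (hΛ : 0 < Λ) (hβM : β ^ 3 ≤ (M : ℝ)) (hMN : 2 * M ≤ N)
    (Φ : ℝ → TorusSite 2 L → ℂ) (P : TorusSite 1 N → TorusSite 2 L → ℂ)
    (hP : ∀ q₀ qv, P q₀ qv = if (q₀ 0).val < 2 * M then ((1 / (β * (L : ℝ) ^ 2) : ℝ) : ℂ) ^ 2 * Φ (gridFreq M N β q₀) qv else 0)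
    (Q Q' : ℕ → ℝ) (v₁ v₂ : TorusSite 2 L) {a b : ℕ}
    (hV : ∀ ω qv, ‖(fwdDiff v₁)^[a] ((fwdDiff v₂)^[b] (Φ ω)) qv‖ ≤
      (2 * Real.pi / L) ^ (a + b) * (β * (L : ℝ) ^ 2 * Q (a + b)) * (2 / max |ω| (Λ / 2)))
    (hD : ∀ ω qv, ‖(fwdDiff v₁)^[a] ((fwdDiff v₂)^[b] (Φ (ω + 2 * Real.pi / β))) qv -
        (fwdDiff v₁)^[a] ((fwdDiff v₂)^[b] (Φ ω)) qv‖ ≤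
      (2 * Real.pi / L) ^ (a + b) * (2 * Real.pi / β * (β * (L : ℝ) ^ 2 * Q' (a + b))) * (2 / max (|ω| - 2 * Real.pi / β) (Λ / 2))) :
    ∑ q₀ : TorusSite 1 N, ∑ qv : TorusSite 2 L,
        ‖(fwdDiff (fun _ : Fin 1 => (1 : ZMod N)))^[1] (fun q => (fwdDiff v₁)^[a] ((fwdDiff v₂)^[b] (P q)) qv) q₀‖ ^ 2 ≤
      uvPieceSq Λ Q Q' 1 (a + b) / ((L : ℝ) ^ (2 * (a + b) + 2) * β ^ (2 * 1 + 1)) := by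
  obtain ⟨hβ, hM1, h8, hMN'⟩ := thresholds_aux hβ2 hβM hMN
  have hL : (0 : ℝ) < L := by exact_mod_cast Nat.pos_of_ne_zero (NeZero.ne L)
  have h := sum_sum_norm_sq_timeDiff_window_le (L := L) (M := M) (N := N) hβ hΛ hM1 hMN (1 / (β * (L : ℝ) ^ 2))
    (fun ω => (fwdDiff v₁)^[a] ((fwdDiff v₂)^[b] (Φ ω))) hV hD
  have heq : ∀ q₀ qv, ‖(fwdDiff (fun _ : Fin 1 => (1 : ZMod N)))^[1] (fun q => (fwdDiff v₁)^[a] ((fwdDiff v₂)^[b] (P q)) qv) q₀‖ ^ 2 =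
      ‖(if ((q₀ + fun _ : Fin 1 => (1 : ZMod N)) 0).val < 2 * M then ((1 / (β * (L : ℝ) ^ 2) : ℝ) : ℂ) ^ 2 *
          (fun ω => (fwdDiff v₁)^[a] ((fwdDiff v₂)^[b] (Φ ω))) (gridFreq M N β (q₀ + fun _ : Fin 1 => (1 : ZMod N))) qv else 0) -
        (if (q₀ 0).val < 2 * M then ((1 / (β * (L : ℝ) ^ 2) : ℝ) : ℂ) ^ 2 *
          (fun ω => (fwdDiff v₁)^[a] ((fwdDiff v₂)^[b] (Φ ω))) (gridFreq M N β q₀) qv else 0)‖ ^ 2 := by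
    intro q₀ qv
    rw [Function.iterate_one, fwdDiff, spaceDiff_window _ Φ P hP, spaceDiff_window _ Φ P hP]
  simp_rw [heq]
  -- the edge envelope: `2/max(π(2M-1)/β, Λ/2) ≤ 2/(πβ²)`
  have hM2 : β ^ 3 ≤ 2 * (M : ℝ) - 1 := by
    have : (1 : ℝ) ≤ M := by exact_mod_cast hM1
    linarith
  have hext : 2 / max (Real.pi * (2 * M - 1) / β) (Λ / 2) ≤ 2 / (Real.pi * β ^ 2) := by
    have hpos : 0 < Real.pi * β ^ 2 := by positivity
    have hle : Real.pi * β ^ 2 ≤ Real.pi * (2 * M - 1) / β := by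
      rw [le_div_iff₀ hβ]; nlinarith [Real.pi_pos, hM2]
    exact div_le_div_of_nonneg_left (by norm_num) hpos (hle.trans (le_max_left _ _))
  rw [div_pow (2 * Real.pi) (L : ℝ) (a + b)] at h
  rw [uvPieceSq, if_neg one_ne_zero,
    show (2 * Real.pi) ^ (2 * (a + b) + 2) = ((2 * Real.pi) ^ (a + b)) ^ 2 * (2 * Real.pi) ^ 2 by ring,
    show (2 * Real.pi) ^ (2 * (a + b)) = ((2 * Real.pi) ^ (a + b)) ^ 2 by ring,
    show (L : ℝ) ^ (2 * (a + b) + 2) = ((L : ℝ) ^ (a + b)) ^ 2 * (L : ℝ) ^ 2 by ring]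
  exact h.trans (piece_algebra_t1 (X := (2 * Real.pi) ^ (a + b)) (Qk := Q (a + b)) (Q'k := Q' (a + b)) hβ2 h8 hΛ hL
    (by positivity) (div_nonneg zero_le_two (le_max_of_le_right (by positivity))) hext)

end Compact

/-! ### §3 The weighted Plancherel inequality with the space monomial -/

section Moment

variable [NeZero L] [NeZero N] {β Λ : ℝ}

/-- **The first SPACE moment at integer scales `R₀, R ≥ 1`**: for a piece `P` whose differenced `ℓ²` norms obey the compact table
`Σ‖Δ_u^tΔ_{e_l}^aΔ_{e_{l'}}^b P‖² ≤ Kq(t,a+b)/(L^{2(a+b)+2}β^{2t+1})` (`t ≤ 1 ≤ a + b ≤ 3`), with `Y = 4|b̃_l|/L`,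
`Σ_{a,b⃗} Y·‖S[P](a,b⃗)‖ ≤ √(216·R₀·R²)·(1/L)·√(N·Σ_e (N/(4R₀))^{2e₀}(1/(4R))^{2(e₁+e₂)}·Kq(e₀,1+e₁+e₂)/β^{2e₀+1})`.
[cite: BenfattoGiulianiMastropietro2006, Lemma 2.2, (2.36aa) and (3.3)] -/
theorem sum_sum_spaceWeight_mul_norm_charSum_le (hβ : 0 < β) (P : TorusSite 1 N → TorusSite 2 L → ℂ) (Kq : ℕ → ℕ → ℝ)
    (hKq : ∀ t k, 0 ≤ Kq t k) {l l' : Fin 2} (hll' : l ≠ l')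
    (hS : ∀ (t a b : ℕ), t ≤ 1 → 1 ≤ a + b → a + b ≤ 3 →
      ∑ p : TorusSite 1 N, ∑ p' : TorusSite 2 L,
          ‖(fwdDiff (fun _ : Fin 1 => (1 : ZMod N)))^[t]
            (fun q => (fwdDiff (Pi.single l (1 : ZMod L) : TorusSite 2 L))^[a]
              ((fwdDiff (Pi.single l' (1 : ZMod L) : TorusSite 2 L))^[b] (P q)) p') p‖ ^ 2 ≤
        Kq t (a + b) / ((L : ℝ) ^ (2 * (a + b) + 2) * β ^ (2 * t + 1)))
    {R₀ R : ℕ} (hR₀ : 1 ≤ R₀) (hR : 1 ≤ R) :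
    ∑ a : TorusSite 1 N, ∑ bv : TorusSite 2 L,
        4 * |(((bv l).valMinAbs : ℤ) : ℝ)| / L *
          ‖∑ q₀ : TorusSite 1 N, ∑ qv : TorusSite 2 L, torusChar q₀ a * torusChar qv bv * P q₀ qv‖ ≤
      Real.sqrt (216 * R₀ * (R : ℝ) ^ 2) *
        Real.sqrt ((N : ℝ) / (L : ℝ) ^ 2 * ∑ e : Fin 2 × Fin 2 × Fin 2,
          (((N : ℝ) / (4 * R₀)) ^ 2) ^ (e.1 : ℕ) * ((1 / (4 * (R : ℝ))) ^ 2) ^ ((e.2.1 : ℕ) + (e.2.2 : ℕ)) *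
            (Kq (e.1 : ℕ) (1 + (e.2.1 : ℕ) + (e.2.2 : ℕ)) / β ^ (2 * (e.1 : ℕ) + 1))) := by
  have hprod : ∀ b : TorusSite 2 L, (1 + (((b l).valMinAbs : ℝ) / R) ^ 2) * (1 + (((b l').valMinAbs : ℝ) / R) ^ 2) =
      ∏ i : Fin 2, (1 + (((b i).valMinAbs : ℝ) / R) ^ 2) := by
    intro b
    rw [Fin.prod_univ_two]
    fin_cases l <;> fin_cases l' <;> simp_all [mul_comm]
  have hL : (0 : ℝ) < L := by exact_mod_cast Nat.pos_of_ne_zero (NeZero.ne L)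
  have hNpos : (0 : ℝ) < N := by exact_mod_cast Nat.pos_of_ne_zero (NeZero.ne N)
  have hR0r : (0 : ℝ) < R₀ := by exact_mod_cast hR₀
  have hRr : (0 : ℝ) < R := by exact_mod_cast hR
  set c₀ : ℝ := ((N : ℝ) / (4 * R₀)) ^ 2 with hc₀
  set cX : ℝ := ((L : ℝ) / (4 * R)) ^ 2 with hcX
  have hP := sum_sum_monomial_mul_norm_prodChar_le_prodWeight (d₁ := 1) (L₁ := N) (d₂ := 2) (L₂ := L) P
    (fun _ : Fin 1 => (1 : ZMod N)) (Pi.single l (1 : ZMod L) : TorusSite 2 L) (Pi.single l' (1 : ZMod L) : TorusSite 2 L)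
    0 1 0 1 1 1 (c₀ := c₀) (c₁ := cX) (c₂ := cX) (by positivity) (by positivity) (by positivity)
  have h1 : ∀ a : TorusSite 1 N, (∑ j, (fun _ : Fin 1 => (1 : ZMod N)) j * a j) = a 0 := fun a => by simp
  have h2 : ∀ (i : Fin 2) (b : TorusSite 2 L), (∑ j, (Pi.single i (1 : ZMod L) : TorusSite 2 L) j * b j) = b i := by
    intro i b; simp [Pi.single_apply]
  simp only [h1, h2] at hP
  simp only [pow_one, pow_zero, mul_one, one_mul, zero_add] at hP
  refine hP.trans (mul_le_mul ?_ ?_ (Real.sqrt_nonneg _) (Real.sqrt_nonneg _))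
  · -- the inverse weight sum factorises: `≤ 6R₀ · 36R²`
    refine Real.sqrt_le_sqrt ?_
    have hrw : ∀ (a : TorusSite 1 N) (b : TorusSite 2 L),
        ((1 + c₀ * (4 * |((a 0).valMinAbs : ℝ)| / N) ^ 2) *
          (1 + cX * (4 * |((b l).valMinAbs : ℝ)| / L) ^ 2) * (1 + cX * (4 * |((b l').valMinAbs : ℝ)| / L) ^ 2))⁻¹ =
          ((1 + (((a 0).valMinAbs : ℝ) / R₀) ^ 2) *
            ((1 + (((b l).valMinAbs : ℝ) / R) ^ 2) * (1 + (((b l').valMinAbs : ℝ) / R) ^ 2)))⁻¹ := by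
      intro a b
      have hNne : (N : ℝ) ≠ 0 := hNpos.ne'
      have hLne : (L : ℝ) ≠ 0 := hL.ne'
      have hfac : ∀ (A x Rr : ℝ), Rr ≠ 0 → A ≠ 0 → (A / (4 * Rr)) ^ 2 * (4 * |x| / A) ^ 2 = (x / Rr) ^ 2 := by
        intro A x Rr hRr hA
        rw [← mul_pow, show A / (4 * Rr) * (4 * |x| / A) = |x| / Rr by field_simp, div_pow, sq_abs, ← div_pow]
      rw [hc₀, hcX, hfac _ _ _ hR0r.ne' hNne, hfac _ _ _ hRr.ne' hLne, hfac _ _ _ hRr.ne' hLne, mul_assoc]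
    simp_rw [hrw]
    rw [sum_sum_inv_prodWeight_eq_mul (fun a : TorusSite 1 N => 1 + (((a 0).valMinAbs : ℝ) / R₀) ^ 2)
      (fun b : TorusSite 2 L => (1 + (((b l).valMinAbs : ℝ) / R) ^ 2) * (1 + (((b l').valMinAbs : ℝ) / R) ^ 2))]
    have hT : ∑ a : TorusSite 1 N, (1 + (((a 0).valMinAbs : ℝ) / R₀) ^ 2)⁻¹ ≤ 6 * (R₀ : ℝ) := by
      have h := sum_inv_one_add_valMinAbs_div_sq_le (L := N) hR₀
      simp_rw [one_div] at h
      have he : ∑ a : TorusSite 1 N, (1 + (((a 0).valMinAbs : ℝ) / R₀) ^ 2)⁻¹ =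
          ∑ x : ZMod N, (1 + ((x.valMinAbs : ℝ) / R₀) ^ 2)⁻¹ := by
        refine Fintype.sum_equiv (Equiv.funUnique (Fin 1) (ZMod N)) _ _ fun a => ?_
        simp [Equiv.funUnique]
      rw [he]; exact h
    -- the space factor: `{l, l'} = {0, 1}`
    have hX : ∑ b : TorusSite 2 L, ((1 + (((b l).valMinAbs : ℝ) / R) ^ 2) * (1 + (((b l').valMinAbs : ℝ) / R) ^ 2))⁻¹ ≤
        36 * (R : ℝ) ^ 2 := by
      have h := sum_prod_inv_one_add_valMinAbs_div_sq_le (L := L) hR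
      refine le_trans (le_of_eq (sum_congr rfl fun b _ => ?_)) h
      rw [hprod b, ← Finset.prod_inv_distrib]
    have hT0 : 0 ≤ ∑ a : TorusSite 1 N, (1 + (((a 0).valMinAbs : ℝ) / R₀) ^ 2)⁻¹ := sum_nonneg fun a _ => by positivity
    calc (∑ a : TorusSite 1 N, (1 + (((a 0).valMinAbs : ℝ) / R₀) ^ 2)⁻¹) *
          ∑ b : TorusSite 2 L, ((1 + (((b l).valMinAbs : ℝ) / R) ^ 2) * (1 + (((b l').valMinAbs : ℝ) / R) ^ 2))⁻¹
        ≤ (6 * (R₀ : ℝ)) * (36 * (R : ℝ) ^ 2) := mul_le_mul hT hX (sum_nonneg fun b _ => by positivity) (by positivity)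
      _ = 216 * R₀ * (R : ℝ) ^ 2 := by ring
  · -- the eight mixed `ℓ²` norms
    refine Real.sqrt_le_sqrt ?_
    rw [show (N : ℝ) * (L : ℝ) ^ 2 = (N : ℝ) / (L : ℝ) ^ 2 * (L : ℝ) ^ 4 by
      rw [div_mul_eq_mul_div, eq_div_iff (by positivity)]; ring, mul_assoc]
    refine mul_le_mul_of_nonneg_left ?_ (by positivity)
    rw [mul_sum]
    refine sum_le_sum fun e _ => ?_
    have he1 : (e.1 : ℕ) ≤ 1 := Nat.lt_succ_iff.1 e.1.isLt
    have he21 : (e.2.1 : ℕ) ≤ 1 := Nat.lt_succ_iff.1 e.2.1.isLt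
    have he22 : (e.2.2 : ℕ) ≤ 1 := Nat.lt_succ_iff.1 e.2.2.isLt
    have hq := hS ((e.1 : ℕ) * 1) (1 + (e.2.1 : ℕ) * 1) ((e.2.2 : ℕ) * 1) (by omega) (by omega) (by omega)
    have hK0 := hKq (e.1 : ℕ) (1 + (e.2.1 : ℕ) + (e.2.2 : ℕ))
    simp only [mul_one] at hq
    calc (L : ℝ) ^ 4 * (c₀ ^ (e.1 : ℕ) * cX ^ (e.2.1 : ℕ) * cX ^ (e.2.2 : ℕ) *
          ∑ p : TorusSite 1 N, ∑ p' : TorusSite 2 L,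
            ‖(fwdDiff (fun _ : Fin 1 => (1 : ZMod N)))^[(e.1 : ℕ)]
              (fun q => ((fwdDiff (Pi.single l (1 : ZMod L) : TorusSite 2 L))^[1 + (e.2.1 : ℕ)]
                ((fwdDiff (Pi.single l' (1 : ZMod L) : TorusSite 2 L))^[(e.2.2 : ℕ)] (P q))) p') p‖ ^ 2)
        ≤ (L : ℝ) ^ 4 * (c₀ ^ (e.1 : ℕ) * cX ^ (e.2.1 : ℕ) * cX ^ (e.2.2 : ℕ) *
          (Kq (e.1 : ℕ) (1 + (e.2.1 : ℕ) + (e.2.2 : ℕ)) /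
            ((L : ℝ) ^ (2 * (1 + (e.2.1 : ℕ) + (e.2.2 : ℕ)) + 2) * β ^ (2 * (e.1 : ℕ) + 1)))) := by
          gcongr
      _ = c₀ ^ (e.1 : ℕ) * ((1 / (4 * (R : ℝ))) ^ 2) ^ ((e.2.1 : ℕ) + (e.2.2 : ℕ)) *
          (Kq (e.1 : ℕ) (1 + (e.2.1 : ℕ) + (e.2.2 : ℕ)) / β ^ (2 * (e.1 : ℕ) + 1)) := by
          obtain ⟨e0, e1, e2⟩ := e
          fin_cases e0 <;> fin_cases e1 <;> fin_cases e2 <;> simp [hcX] <;> field_simp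

/-- **The space-moment constant** `X(Λ,R,Kq) = ¼·√(216R²(1/Λ + 1/2))·√(Σ_e (Λ/4)^{2e₀}(1/(4R))^{2(e₁+e₂)}·Kq(e₀,1+e₁+e₂))`.
[cite: BenfattoGiulianiMastropietro2006, §2.8 (2.80)–(2.81)] -/
def uvSpaceMomentConst (Λ : ℝ) (R : ℕ) (Kq : ℕ → ℕ → ℝ) : ℝ :=
  1 / 4 * Real.sqrt (216 * (R : ℝ) ^ 2 * (1 / Λ + 1 / 2)) *
    Real.sqrt (∑ e : Fin 2 × Fin 2 × Fin 2, ((Λ / 4) ^ 2) ^ (e.1 : ℕ) * ((1 / (4 * (R : ℝ))) ^ 2) ^ ((e.2.1 : ℕ) + (e.2.2 : ℕ)) *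
      Kq (e.1 : ℕ) (1 + (e.2.1 : ℕ) + (e.2.2 : ℕ)))

/-- `X(Λ,R,Kq) ≥ 0`. [cite: BenfattoGiulianiMastropietro2006, §2.8 (2.80)] -/
theorem uvSpaceMomentConst_nonneg (Λ : ℝ) (R : ℕ) (Kq : ℕ → ℕ → ℝ) : 0 ≤ uvSpaceMomentConst Λ R Kq := by
  unfold uvSpaceMomentConst; positivity

/-- **The first space moment of a piece is `O(1)` in the grid units** (`2 ≤ β`, `0 < Λ`, `β³ ≤ M`, `2M ≤ N`, `R ≥ 1`):
`(β/N)·Σ_{a,b⃗} |b̃_l|·‖S[P](a,b⃗)‖ ≤ uvSpaceMomentConst Λ R Kq` — choose `R₀ = ⌈N/(βΛ)⌉`: then `(N/(4R₀))²/β² ≤ (Λ/4)²`,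
`R₀ ≤ N/(βΛ) + 1`, `β/N ≤ 1/2`, and every `L` cancels. [cite: BenfattoGiulianiMastropietro2006, §2.8 (2.80)–(2.81)] -/
theorem spaceMoment_charSum_piece_le (hβ2 : 2 ≤ β) (hΛ : 0 < Λ) (hβM : β ^ 3 ≤ (M : ℝ)) (hMN : 2 * M ≤ N)
    (P : TorusSite 1 N → TorusSite 2 L → ℂ) (Kq : ℕ → ℕ → ℝ) (hKq : ∀ t k, 0 ≤ Kq t k) {l l' : Fin 2} (hll' : l ≠ l')
    (hS : ∀ (t a b : ℕ), t ≤ 1 → 1 ≤ a + b → a + b ≤ 3 →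
      ∑ p : TorusSite 1 N, ∑ p' : TorusSite 2 L,
          ‖(fwdDiff (fun _ : Fin 1 => (1 : ZMod N)))^[t]
            (fun q => (fwdDiff (Pi.single l (1 : ZMod L) : TorusSite 2 L))^[a]
              ((fwdDiff (Pi.single l' (1 : ZMod L) : TorusSite 2 L))^[b] (P q)) p') p‖ ^ 2 ≤
        Kq t (a + b) / ((L : ℝ) ^ (2 * (a + b) + 2) * β ^ (2 * t + 1)))
    {R : ℕ} (hR : 1 ≤ R) :
    β / N * ∑ a : TorusSite 1 N, ∑ bv : TorusSite 2 L,
        |(((bv l).valMinAbs : ℤ) : ℝ)| * ‖∑ q₀ : TorusSite 1 N, ∑ qv : TorusSite 2 L, torusChar q₀ a * torusChar qv bv * P q₀ qv‖ ≤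
      uvSpaceMomentConst Λ R Kq := by
  obtain ⟨hβ0, hM1, h8, hMN'⟩ := thresholds_aux hβ2 hβM hMN
  have hL : (0 : ℝ) < L := by exact_mod_cast Nat.pos_of_ne_zero (NeZero.ne L)
  have hNpos : (0 : ℝ) < N := by exact_mod_cast Nat.pos_of_ne_zero (NeZero.ne N)
  have hRr : (0 : ℝ) < R := by exact_mod_cast hR
  -- `β/N ≤ 1/2`
  have hβN : β / N ≤ 1 / 2 := by
    rw [div_le_iff₀ hNpos]
    have hβ3 : β ≤ β ^ 3 := by nlinarith [sq_nonneg β]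
    linarith
  -- the time scale
  set R₀ : ℕ := ⌈(N : ℝ) / (β * Λ)⌉₊ with hR₀
  have hR₀pos : (0 : ℝ) < (N : ℝ) / (β * Λ) := by positivity
  have hR₀1 : 1 ≤ R₀ := Nat.one_le_iff_ne_zero.2 (Nat.ceil_pos.2 hR₀pos).ne'
  have hR₀le : (N : ℝ) / (β * Λ) ≤ R₀ := Nat.le_ceil _
  have hR₀lt : (R₀ : ℝ) < (N : ℝ) / (β * Λ) + 1 := Nat.ceil_lt_add_one hR₀pos.le
  have hR₀r : (0 : ℝ) < R₀ := by exact_mod_cast hR₀1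
  have hT := sum_sum_spaceWeight_mul_norm_charSum_le (L := L) hβ0 P Kq hKq hll' hS hR₀1 hR
  -- rewrite the left-hand side as `(β/N)·(L/4)·Σ Y‖S‖`
  have hlhs : β / N * ∑ a : TorusSite 1 N, ∑ bv : TorusSite 2 L,
      |(((bv l).valMinAbs : ℤ) : ℝ)| * ‖∑ q₀ : TorusSite 1 N, ∑ qv : TorusSite 2 L, torusChar q₀ a * torusChar qv bv * P q₀ qv‖ =
      β / N * ((L : ℝ) / 4) * ∑ a : TorusSite 1 N, ∑ bv : TorusSite 2 L,
        4 * |(((bv l).valMinAbs : ℤ) : ℝ)| / L *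
          ‖∑ q₀ : TorusSite 1 N, ∑ qv : TorusSite 2 L, torusChar q₀ a * torusChar qv bv * P q₀ qv‖ := by
    simp only [Finset.mul_sum]
    refine Finset.sum_congr rfl fun a _ => Finset.sum_congr rfl fun bv _ => ?_
    field_simp
  rw [hlhs]
  set KS := ∑ e : Fin 2 × Fin 2 × Fin 2, ((Λ / 4) ^ 2) ^ (e.1 : ℕ) * ((1 / (4 * (R : ℝ))) ^ 2) ^ ((e.2.1 : ℕ) + (e.2.2 : ℕ)) *
    Kq (e.1 : ℕ) (1 + (e.2.1 : ℕ) + (e.2.2 : ℕ)) with hKS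
  have hKS0 : 0 ≤ KS := sum_nonneg fun e _ => by have := hKq (e.1 : ℕ) (1 + (e.2.1 : ℕ) + (e.2.2 : ℕ)); positivity
  have hS2 : (N : ℝ) / (L : ℝ) ^ 2 * ∑ e : Fin 2 × Fin 2 × Fin 2,
      (((N : ℝ) / (4 * R₀)) ^ 2) ^ (e.1 : ℕ) * ((1 / (4 * (R : ℝ))) ^ 2) ^ ((e.2.1 : ℕ) + (e.2.2 : ℕ)) *
        (Kq (e.1 : ℕ) (1 + (e.2.1 : ℕ) + (e.2.2 : ℕ)) / β ^ (2 * (e.1 : ℕ) + 1)) ≤ (N : ℝ) / (L : ℝ) ^ 2 / β * KS := by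
    rw [hKS, mul_sum, mul_sum]
    refine sum_le_sum fun e _ => ?_
    have hK0 := hKq (e.1 : ℕ) (1 + (e.2.1 : ℕ) + (e.2.2 : ℕ))
    have hc : ((N : ℝ) / (4 * R₀)) ^ 2 / β ^ 2 ≤ (Λ / 4) ^ 2 := by
      rw [← div_pow, div_div]
      refine pow_le_pow_left₀ (by positivity) ?_ 2
      rw [div_le_div_iff₀ (by positivity) (by norm_num)]
      have : (N : ℝ) ≤ R₀ * (β * Λ) := by rwa [div_le_iff₀ (by positivity)] at hR₀le
      nlinarith
    have heq : (N : ℝ) / (L : ℝ) ^ 2 * ((((N : ℝ) / (4 * R₀)) ^ 2) ^ (e.1 : ℕ) * ((1 / (4 * (R : ℝ))) ^ 2) ^ ((e.2.1 : ℕ) + (e.2.2 : ℕ)) *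
        (Kq (e.1 : ℕ) (1 + (e.2.1 : ℕ) + (e.2.2 : ℕ)) / β ^ (2 * (e.1 : ℕ) + 1))) =
        (N : ℝ) / (L : ℝ) ^ 2 / β * ((((N : ℝ) / (4 * R₀)) ^ 2 / β ^ 2) ^ (e.1 : ℕ) *
          ((1 / (4 * (R : ℝ))) ^ 2) ^ ((e.2.1 : ℕ) + (e.2.2 : ℕ)) * Kq (e.1 : ℕ) (1 + (e.2.1 : ℕ) + (e.2.2 : ℕ))) := by
      have hb : β ^ (2 * (e.1 : ℕ) + 1) = (β ^ 2) ^ (e.1 : ℕ) * β := by rw [pow_add, pow_mul, pow_one]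
      rw [hb, div_pow _ (β ^ 2)]
      field_simp
    rw [heq]
    refine mul_le_mul_of_nonneg_left ?_ (by positivity)
    gcongr
  have hS1 : 216 * (R₀ : ℝ) * (R : ℝ) ^ 2 ≤ 216 * (R : ℝ) ^ 2 * ((N : ℝ) / (β * Λ) + 1) := by nlinarith [hR₀lt.le]
  have hsq := mul_le_mul (Real.sqrt_le_sqrt hS1) (Real.sqrt_le_sqrt hS2) (Real.sqrt_nonneg _) (Real.sqrt_nonneg _)
  have hfin : β / N * ((L : ℝ) / 4) * (Real.sqrt (216 * (R : ℝ) ^ 2 * ((N : ℝ) / (β * Λ) + 1)) *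
      Real.sqrt ((N : ℝ) / (L : ℝ) ^ 2 / β * KS)) ≤ uvSpaceMomentConst Λ R Kq := by
    set A : ℝ := 216 * (R : ℝ) ^ 2 * ((N : ℝ) / (β * Λ) + 1) with hAdef
    set C : ℝ := 216 * (R : ℝ) ^ 2 * (1 / Λ + β / N) with hCdef
    have hA0 : 0 ≤ A := by positivity
    have hAB : A * ((N : ℝ) / (L : ℝ) ^ 2 / β * KS) = ((N : ℝ) / (β * L)) ^ 2 * (C * KS) := by
      rw [hAdef, hCdef]; field_simp
    have h1 : β / N * ((L : ℝ) / 4) * (Real.sqrt A * Real.sqrt ((N : ℝ) / (L : ℝ) ^ 2 / β * KS)) =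
        1 / 4 * Real.sqrt C * Real.sqrt KS := by
      rw [← Real.sqrt_mul hA0, hAB, Real.sqrt_mul (sq_nonneg _), Real.sqrt_sq (by positivity), Real.sqrt_mul (by positivity)]
      field_simp
    rw [h1, uvSpaceMomentConst, ← hKS, hCdef]
    gcongr
  exact le_trans (mul_le_mul_of_nonneg_left (hT.trans hsq) (by positivity)) hfin

end Moment

end Literature.MathematicalPhysics.QuantumLattice

end
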